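import Summits.ABC.StewartYu.PadicG3SatRecord
import Summits.ABC.StewartYu.PadicG3OddCeilings
import HarnessLib

/-!
# Cell abc-stewartyu, WP-L.P(odd) (crux r3 `PadicCoreOddRat`, stmt-ABC-20503): SLOT CEILINGS of the saturated frame's closed forms in the
# record's currency (logarithms) — `KCsat`, `1 + U·P·MhCsat`, `DCsat`, `AmaxSat`, `PmaxSat`, `UcardSat`

`Summits/ABC/StewartYu/PadicG3SatCeilings.lean` — cell `abc-stewartyu` (HOME `run/shared/lean/pub/abc-stewartyu/`, design memo
HOME/p2/memo-07-WPLP-odd-Nframe-design.md §2 row «ceilings/supplies»; seat p2-g6; for the record owner p1).  Theorems on `G3Setup`; no named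
fact.  Twins of `PadicG3OddCeilings.log_KC_le` / `log_one_add_UPMhCs_le` / `log_AmaxS₂_eq` / `log_PmaxS₂_le` / `log_UcardS₂_eq` with the θ-box
denominators replaced by the VIRTUAL ones, whose own ceilings are `SatData.log_Dm_le_of_weights` / `SatData.log_Dh_le_of_weights`
(`log Dm(Bv,x) ≤ 2|x|·Σⱼ(Bvⱼ/N)Vⱼ + 2ΣVⱼ`, `log Dh(Bv,s) ≤ |s|·Σ(Bvⱼ/N)Vⱼ + Σ(Σᵢ|Uᵢⱼ|/N)Vⱼ + 2ΣVⱼ`):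

* `log_KCsat_le` — `log KCsat ≤ log 2 + log U + log P + log M0C + |t|·log max(1, XbC Lc) + 2·log Dm(Bv, x)`;
* `log_one_add_UPMhCsat_le` — `log(1 + U·P·MhCsat) ≤ log 2 + log U + log P + t₀ log 2 + log M0C(lev+1) + |t|·log max(1, XbC Lc) + log Dh(Bv, s₁)`;
* `log_DCsat_le` — `log DCsat ≤ t₀·log ν(H) + |t|·log|b̃_{k₀}| + log Dh(Bv, s₁)`;
* `log_AmaxSat_eq`, `log_PmaxSat_le`, `log_UcardSat_le` (`#satFam ≤ ∏(2·LcSₖ + 1)`).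

WHAT THIS IS NOT: the record's budgets; no crux moves.

References: Yu. V. Nesterenko, LNM 1819 (2003) §3.2 (3.26), §4.2 (4.31), §4.3 (4.41); K. Yu, Acta Math. 211 (2013) §5.
-/

noncomputable section

open NormedSpace Finset Polynomial
open scoped Matrix
open Literature.NumberTheory.Transcendental
open Literature.NumberTheory.Transcendental.CW77.Setup (Tau tauNorm)
open scoped Nat

namespace Summit.ABC.StewartYu

namespace G3Setup

variable {p : ℕ} [Fact p.Prime] (S : G3Setup p) (F : S.SatData) (Sc : G3Sched S.n)

/-- `1 ≤ M0C` (real form; local copy). [folklore] -/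
private theorem one_le_M0C_real' (L₀ H Sh lev : ℕ) (x : ℤ) (t₀ : ℕ) : (1 : ℝ) ≤ (M0C L₀ H Sh lev x t₀ : ℝ) := by
  have h1 : (1 : ℤ) ≤ M0C L₀ H Sh lev x t₀ := by
    unfold M0C
    refine Int.one_le_ceil_iff.mpr ?_
    have hb : (1 : ℝ) ≤ Real.exp 1 * (1 + |((2 ^ (Sh - lev) * x : ℤ) : ℝ)| / H) := by
      have : (1 : ℝ) ≤ Real.exp 1 := Real.one_le_exp zero_le_one
      have : (0 : ℝ) ≤ |((2 ^ (Sh - lev) * x : ℤ) : ℝ)| / H := by positivity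
      nlinarith
    have h2 : (1 : ℝ) ≤ (2 : ℝ) ^ ((Sh - lev) * t₀) := one_le_pow₀ (by norm_num)
    have h3 : (1 : ℝ) ≤ (Nat.lcmUpto H : ℝ) ^ t₀ := one_le_pow₀ (by exact_mod_cast Nat.lcmUpto_pos H)
    have h4 : (1 : ℝ) ≤ Real.exp (H / Real.exp 1) := Real.one_le_exp (by positivity)
    have h5 : (1 : ℝ) ≤ (Real.exp 1 * (1 + |((2 ^ (Sh - lev) * x : ℤ) : ℝ)| / H)) ^ L₀ := one_le_pow₀ hb
    have h6 := one_le_mul_of_one_le_of_one_le h2 (one_le_mul_of_one_le_of_one_le h3 (one_le_mul_of_one_le_of_one_le h4 h5))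
    linarith
  exact_mod_cast h1

/-- `0 ≤ XbC`. [folklore] -/
private theorem XbC_nonneg'' (L : Fin S.n → ℕ) : (0 : ℝ) ≤ (S.XbC L : ℝ) := by
  have : (0 : ℤ) ≤ S.XbC L := by
    unfold XbC; exact mul_nonneg (by norm_num) (mul_nonneg (sum_nonneg fun j _ => abs_nonneg _) (sum_nonneg fun j _ => by positivity))
  exact_mod_cast this

/-- **`log KCsat ≤ log 2 + log U + log P + log M0C(lev, x, t₀) + |t|·log max(1, XbC Lc) + 2·log Dm(Bv, x)`** for `U ≥ 1`, `P ≥ 1`.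
[cite: Nesterenko2003, §4.2 (4.31); shape only] -/
theorem log_KCsat_le {U : ℕ} (hU : 1 ≤ U) {P : ℤ} (hP : 1 ≤ P) (L₀ H Sh lev : ℕ) (Lc Bv : Fin S.n → ℕ) (x : ℤ) (τ : Tau S.n) :
    Real.log (S.KCsat F U P L₀ H Sh lev Lc Bv x τ) ≤ Real.log 2 + Real.log U + Real.log P + Real.log (M0C L₀ H Sh lev x τ.1 : ℝ) +
      (∑ k, τ.2 k : ℕ) * Real.log (max 1 (S.XbC Lc : ℝ)) + 2 * Real.log (F.Dm Bv x : ℝ) := by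
  have hU' : (1 : ℝ) ≤ U := by exact_mod_cast hU
  have hP' : (1 : ℝ) ≤ P := by exact_mod_cast hP
  have hM : (1 : ℝ) ≤ (M0C L₀ H Sh lev x τ.1 : ℝ) := one_le_M0C_real' L₀ H Sh lev x τ.1
  have hmon : (1 : ℝ) ≤ (F.Dm Bv x : ℝ) := by exact_mod_cast F.one_le_Dm Bv x
  have hX0 := S.XbC_nonneg'' Lc
  have hXm : (1 : ℝ) ≤ max 1 (S.XbC Lc : ℝ) := le_max_left _ _
  set Y : ℝ := (U : ℝ) * P * ((M0C L₀ H Sh lev x τ.1 : ℝ) * (max 1 (S.XbC Lc : ℝ)) ^ (∑ k, τ.2 k) * ((F.Dm Bv x : ℝ)) ^ 2) with hY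
  have hKY : S.KCsat F U P L₀ H Sh lev Lc Bv x τ ≤ 2 * Y := by
    unfold KCsat
    have hle : (U : ℝ) * P * ((M0C L₀ H Sh lev x τ.1 : ℝ) * (S.XbC Lc : ℝ) ^ (∑ k, τ.2 k) * ((F.Dm Bv x : ℝ)) ^ 2) ≤ Y := by
      rw [hY]
      have hxp : (S.XbC Lc : ℝ) ^ (∑ k, τ.2 k) ≤ (max 1 (S.XbC Lc : ℝ)) ^ (∑ k, τ.2 k) := pow_le_pow_left₀ hX0 (le_max_right _ _) _
      have hM0 : (0 : ℝ) ≤ (M0C L₀ H Sh lev x τ.1 : ℝ) := le_trans zero_le_one hM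
      refine mul_le_mul_of_nonneg_left (mul_le_mul_of_nonneg_right (mul_le_mul_of_nonneg_left hxp hM0) (by positivity)) ?_
      exact mul_nonneg (le_trans zero_le_one hU') (le_trans zero_le_one hP')
    have hY1 : 1 ≤ Y := by
      have h1 : (1 : ℝ) ≤ (M0C L₀ H Sh lev x τ.1 : ℝ) * (max 1 (S.XbC Lc : ℝ)) ^ (∑ k, τ.2 k) * ((F.Dm Bv x : ℝ)) ^ 2 :=
        one_le_mul_of_one_le_of_one_le (one_le_mul_of_one_le_of_one_le hM (one_le_pow₀ hXm)) (one_le_pow₀ hmon)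
      exact one_le_mul_of_one_le_of_one_le (one_le_mul_of_one_le_of_one_le hU' hP') h1
    linarith
  have hK0 : 0 < S.KCsat F U P L₀ H Sh lev Lc Bv x τ :=
    lt_of_lt_of_le zero_lt_one (S.one_le_KCsat F U (le_trans zero_le_one hP) L₀ H Sh lev Lc Bv x τ)
  have hlogY : Real.log Y = Real.log U + Real.log P + Real.log (M0C L₀ H Sh lev x τ.1 : ℝ) +
      (∑ k, τ.2 k : ℕ) * Real.log (max 1 (S.XbC Lc : ℝ)) + 2 * Real.log (F.Dm Bv x : ℝ) := by
    rw [hY, Real.log_mul (by positivity) (by positivity), Real.log_mul (by positivity) (by positivity),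
      Real.log_mul (by positivity) (by positivity), Real.log_mul (by positivity) (by positivity), Real.log_pow, Real.log_pow]
    push_cast; ring
  calc Real.log (S.KCsat F U P L₀ H Sh lev Lc Bv x τ) ≤ Real.log (2 * Y) := Real.log_le_log hK0 hKY
    _ = Real.log 2 + Real.log Y := Real.log_mul (by norm_num) (by positivity)
    _ = _ := by rw [hlogY]; ring

/-- **`log(1 + U·P·MhCsat) ≤ log 2 + log U + log P + t₀·log 2 + log M0C(lev+1, s₁, t₀) + |t|·log max(1, XbC Lc) + log Dh(Bv, s₁)`**
for `U, P ≥ 1`. [cite: Nesterenko2003, §4.3 (4.41); shape only] -/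
theorem log_one_add_UPMhCsat_le {U : ℕ} (hU : 1 ≤ U) {P : ℤ} (hP : 1 ≤ P) (Lc Bv : Fin S.n → ℕ) (L₀ H Sh lev : ℕ) (s₁ : ℤ)
    (τ : Tau S.n) :
    Real.log (1 + (U : ℝ) * P * S.MhCsat F Lc Bv L₀ H Sh lev s₁ τ) ≤ Real.log 2 + Real.log U + Real.log P + τ.1 * Real.log 2 +
      Real.log (M0C L₀ H Sh (lev + 1) s₁ τ.1 : ℝ) + (∑ k, τ.2 k : ℕ) * Real.log (max 1 (S.XbC Lc : ℝ)) +
      Real.log (F.Dh Bv s₁ : ℝ) := by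
  have hU' : (1 : ℝ) ≤ U := by exact_mod_cast hU
  have hP' : (1 : ℝ) ≤ P := by exact_mod_cast hP
  have hM : (1 : ℝ) ≤ (M0C L₀ H Sh (lev + 1) s₁ τ.1 : ℝ) := one_le_M0C_real' L₀ H Sh (lev + 1) s₁ τ.1
  have hh : (1 : ℝ) ≤ (F.Dh Bv s₁ : ℝ) := by exact_mod_cast F.one_le_Dh Bv s₁
  have hX0 := S.XbC_nonneg'' Lc
  have hXm : (1 : ℝ) ≤ max 1 (S.XbC Lc : ℝ) := le_max_left _ _
  set Y : ℝ := (U : ℝ) * P * ((2 : ℝ) ^ τ.1 * (M0C L₀ H Sh (lev + 1) s₁ τ.1 : ℝ) * (max 1 (S.XbC Lc : ℝ)) ^ (∑ k, τ.2 k) *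
    (F.Dh Bv s₁ : ℝ)) with hY
  have hle : 1 + (U : ℝ) * P * S.MhCsat F Lc Bv L₀ H Sh lev s₁ τ ≤ 2 * Y := by
    have h1 : (U : ℝ) * P * S.MhCsat F Lc Bv L₀ H Sh lev s₁ τ ≤ Y := by
      rw [hY]; unfold MhCsat
      have hxp : (S.XbC Lc : ℝ) ^ (∑ k, τ.2 k) ≤ (max 1 (S.XbC Lc : ℝ)) ^ (∑ k, τ.2 k) := pow_le_pow_left₀ hX0 (le_max_right _ _) _
      have hM0 : (0 : ℝ) ≤ (2 : ℝ) ^ τ.1 * (M0C L₀ H Sh (lev + 1) s₁ τ.1 : ℝ) := by have := le_trans zero_le_one hM; positivity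
      refine mul_le_mul_of_nonneg_left (mul_le_mul_of_nonneg_right (mul_le_mul_of_nonneg_left hxp hM0) (le_trans zero_le_one hh)) ?_
      exact mul_nonneg (le_trans zero_le_one hU') (le_trans zero_le_one hP')
    have hY1 : 1 ≤ Y := by
      have h1 : (1 : ℝ) ≤ (2 : ℝ) ^ τ.1 * (M0C L₀ H Sh (lev + 1) s₁ τ.1 : ℝ) * (max 1 (S.XbC Lc : ℝ)) ^ (∑ k, τ.2 k) * (F.Dh Bv s₁ : ℝ) :=
        one_le_mul_of_one_le_of_one_le (one_le_mul_of_one_le_of_one_le (one_le_mul_of_one_le_of_one_le (one_le_pow₀ (by norm_num)) hM)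
          (one_le_pow₀ hXm)) hh
      exact one_le_mul_of_one_le_of_one_le (one_le_mul_of_one_le_of_one_le hU' hP') h1
    linarith
  have hpos : 0 < 1 + (U : ℝ) * P * S.MhCsat F Lc Bv L₀ H Sh lev s₁ τ := by
    have := S.MhCsat_nonneg F Lc Bv L₀ H Sh lev s₁ τ
    have : (0 : ℝ) ≤ (U : ℝ) * P * S.MhCsat F Lc Bv L₀ H Sh lev s₁ τ := by
      have := le_trans zero_le_one hU'; have := le_trans zero_le_one hP'; positivity
    linarith
  have hlogY : Real.log Y = Real.log U + Real.log P + τ.1 * Real.log 2 + Real.log (M0C L₀ H Sh (lev + 1) s₁ τ.1 : ℝ) +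
      (∑ k, τ.2 k : ℕ) * Real.log (max 1 (S.XbC Lc : ℝ)) + Real.log (F.Dh Bv s₁ : ℝ) := by
    rw [hY, Real.log_mul (by positivity) (by positivity), Real.log_mul (by positivity) (by positivity),
      Real.log_mul (by positivity) (by positivity), Real.log_mul (by positivity) (by positivity),
      Real.log_mul (by positivity) (by positivity), Real.log_pow, Real.log_pow]
    push_cast; ring
  calc Real.log (1 + (U : ℝ) * P * S.MhCsat F Lc Bv L₀ H Sh lev s₁ τ) ≤ Real.log (2 * Y) := Real.log_le_log hpos hle
    _ = Real.log 2 + Real.log Y := Real.log_mul (by norm_num) (by positivity)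
    _ = _ := by rw [hlogY]; ring

/-- **`log DCsat = t₀·log ν(H) + |t|·log|b̃_{k₀}| + log Dh(Bv, s₁)`.** [cite: Nesterenko2003, (3.26); shape only] -/
theorem log_DCsat_eq (Bv : Fin S.n → ℕ) (H : ℕ) (s₁ : ℤ) (τ : Tau S.n) :
    Real.log (S.DCsat F Bv H s₁ τ : ℝ) = τ.1 * Real.log (Nat.lcmUpto H : ℝ) + (∑ k, τ.2 k : ℕ) * Real.log ((S.b S.j₀).natAbs : ℝ) +
      Real.log (F.Dh Bv s₁ : ℝ) := by
  have hν : (0 : ℝ) < (Nat.lcmUpto H : ℝ) := by exact_mod_cast Nat.lcmUpto_pos H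
  have hb1 : (0 : ℝ) < (((S.b S.j₀).natAbs : ℕ) : ℝ) := by exact_mod_cast Int.natAbs_pos.mpr S.bj₀_ne
  have hD : (0 : ℝ) < (F.Dh Bv s₁ : ℝ) := by exact_mod_cast F.one_le_Dh Bv s₁
  unfold DCsat
  push_cast
  rw [Real.log_mul (by positivity) hD.ne', Real.log_mul (by positivity) (by positivity), Real.log_pow, Real.log_pow]
  push_cast; ring

/-- **`log AmaxSat = log M0C(L₀,H,Ŝ,0,X₀,T₀) + T₀·log XbSSat + 2·log Dm(Lb svS 0, X₀)`** (`X₀ = NS 0 0`, `T₀ = TordS 0 0`).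
[cite: Nesterenko2003, (3.26); shape only] -/
theorem log_AmaxSat_eq :
    Real.log (S.AmaxSat F Sc) = Real.log (M0C Sc.L₀ Sc.H Sc.Sd 0 (S.NS Sc 0 0 : ℤ) (S.TordS Sc 0 0) : ℝ) +
      (S.TordS Sc 0 0 : ℕ) * Real.log (S.XbSSat F Sc : ℝ) + 2 * Real.log (F.Dm (S.Lb (S.svS F Sc) 0) (S.NS Sc 0 0 : ℤ) : ℝ) := by
  have hM : (1 : ℝ) ≤ (M0C Sc.L₀ Sc.H Sc.Sd 0 (S.NS Sc 0 0 : ℤ) (S.TordS Sc 0 0) : ℝ) := one_le_M0C_real' _ _ _ _ _ _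
  have hX : (1 : ℝ) ≤ (S.XbSSat F Sc : ℝ) := by unfold XbSSat; exact_mod_cast le_max_left _ _
  have hmon : (1 : ℝ) ≤ (F.Dm (S.Lb (S.svS F Sc) 0) (S.NS Sc 0 0 : ℤ) : ℝ) := by exact_mod_cast F.one_le_Dm _ _
  unfold AmaxSat
  rw [Real.log_mul (by positivity) (by positivity), Real.log_mul (by positivity) (by positivity), Real.log_pow, Real.log_pow]
  push_cast; ring

/-- `XbSSat = max 1 (XbC (Lb LcS 0))` as a real. [folklore] -/
theorem XbSSat_cast : (S.XbSSat F Sc : ℝ) = max 1 (S.XbC (S.Lb (S.LcS F Sc) 0) : ℝ) := by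
  unfold XbSSat; push_cast; rfl

/-- `1 ≤ UcardSat` as soon as the skew family is non-empty (it contains `0`). [folklore] -/
theorem one_le_UcardSat : 1 ≤ S.UcardSat F Sc := by
  unfold UcardSat
  refine one_le_mul (by omega) (Finset.card_pos.mpr ⟨0, ?_⟩)
  rw [S.mem_satFam]
  exact ⟨fun k => by simp, fun j => by simp⟩

/-- **`log PmaxSat ≤ log 2 + log UcardSat + log AmaxSat`.** [folklore] -/
theorem log_PmaxSat_le : Real.log (S.PmaxSat F Sc : ℝ) ≤ Real.log 2 + Real.log (S.UcardSat F Sc : ℝ) + Real.log (S.AmaxSat F Sc) := by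
  have hU : (1 : ℝ) ≤ S.UcardSat F Sc := by exact_mod_cast S.one_le_UcardSat F Sc
  have hA := S.one_le_AmaxSat F Sc
  have hUA : 1 ≤ (S.UcardSat F Sc : ℝ) * S.AmaxSat F Sc := one_le_mul_of_one_le_of_one_le hU hA
  have hP : (S.PmaxSat F Sc : ℝ) ≤ 2 * ((S.UcardSat F Sc : ℝ) * S.AmaxSat F Sc) := by
    have h1 : (S.PmaxSat F Sc : ℝ) < (S.UcardSat F Sc : ℝ) * S.AmaxSat F Sc + 1 := by
      unfold PmaxSat; exact_mod_cast Int.ceil_lt_add_one _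
    linarith
  have hP1 : (0 : ℝ) < (S.PmaxSat F Sc : ℝ) := by
    have h1 : (1 : ℤ) ≤ S.PmaxSat F Sc := by
      unfold PmaxSat; exact Int.one_le_ceil_iff.mpr (by linarith)
    exact_mod_cast lt_of_lt_of_le zero_lt_one h1
  calc Real.log (S.PmaxSat F Sc : ℝ) ≤ Real.log (2 * ((S.UcardSat F Sc : ℝ) * S.AmaxSat F Sc)) := Real.log_le_log hP1 hP
    _ = Real.log 2 + Real.log (S.UcardSat F Sc : ℝ) + Real.log (S.AmaxSat F Sc) := by
        rw [Real.log_mul (by norm_num) (by positivity), Real.log_mul (by positivity) (by positivity)]; ring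

/-- **`log UcardSat ≤ log(L₀+1) + Σₖ log(2·LcSₖ + 1)`** (`#satFam ≤ #box LcS`). [folklore] -/
theorem log_UcardSat_le : Real.log (S.UcardSat F Sc : ℝ) ≤ Real.log ((Sc.L₀ : ℝ) + 1) + ∑ k, Real.log (2 * (S.LcS F Sc k : ℝ) + 1) := by
  have hle : S.UcardSat F Sc ≤ (Sc.L₀ + 1) * ∏ k, (2 * S.LcS F Sc k + 1) := by
    unfold UcardSat
    rw [← S.card_box]
    exact Nat.mul_le_mul_left _ (card_le_card (S.satFam_subset_box F _ _))
  have hpos : (0 : ℝ) < S.UcardSat F Sc := by exact_mod_cast S.one_le_UcardSat F Sc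
  calc Real.log (S.UcardSat F Sc : ℝ) ≤ Real.log (((Sc.L₀ + 1) * ∏ k, (2 * S.LcS F Sc k + 1) : ℕ) : ℝ) :=
        Real.log_le_log hpos (by exact_mod_cast hle)
    _ = Real.log ((Sc.L₀ : ℝ) + 1) + ∑ k, Real.log (2 * (S.LcS F Sc k : ℝ) + 1) := by
        push_cast
        rw [Real.log_mul (by positivity) (Finset.prod_pos fun j _ => by positivity).ne', Real.log_prod (s := Finset.univ) (fun j _ => by positivity)]

end G3Setup

end Summit.ABC.StewartYu

end
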